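import Summits.QuantumFields.BalabanUV.T4Continuum.Support.NE7HintOfCubeChartSU2
import Summits.QuantumFields.BalabanUV.T4Continuum.Support.NE7CubeGradientOfLandauSup
import Summits.QuantumFields.BalabanUV.T4Continuum.Support.NE7ClassCurrentBound
import Literature.NumberTheory.Sieve.CoprimeSquarefreeSumsBounds
import HarnessLib

/-!
# NE7 — (8)∃ FROM A LOCAL LATTICE-LANDAU CHART WITH THE SUP LETTER ALONE, SU(2)∕U(2) on T⁴, `L = 2` (F302): around every point `z` of every tangent-critical
# admissible configuration a unitary gauge `u₀` and a skew `A` on the sup-cube of radius `(nbRad + 2ℓ + 12)·M + 2` with `U^{u₀} = e^{A}`, `‖A‖ ≤ c₀t∕M` and Landau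
# reaction `‖∇div A‖ ≤ c_r t∕M³` (`c₀, c_r ≤ A(ℓ+1)^p`) ⟹ the GRADIENT letter `‖∇A‖ ≤ c₁t∕M²` (F300 + F301: current of the class, weighted bootstrap) ⟹ (CUBE) of
# F298 ⟹ (8)∃.  THE GRADIENT LETTER OF [B11] Thm 1 (9) IS DISCHARGED FOR OUR CONFIGURATIONS; the chart input of route 1 is now [B8] Thm 2 (1.36)₁ + (1.38) TYPE, LOCAL

Cell `pub-balaban`, rung (B)+1 sub-cell t4, lineage `b2b-balaban-t4-ne7-p1` (CRUX PROVER NE7 #1 = OWNER of row NE7), generation 92; memo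
`t4/b2b-balaban-t4-ne7-p1-g92/LOG-OBSTRUCTION.md` §4 (ROAD (U): bricks (B1) F299∕F300∕F301 assembled; (B2) — the local Landau gauge with the sup letter — is what remains
of the chart).  Over F298 `NE7HintOfCubeChartSU2.hint_of_cubeChart_SU2`, F300 `NE7CubeGradientOfLandauSup.norm_fdiff_le_of_landauSup_cube`, F301
`NE7ClassCurrentBound.exists_classCurrentConst`.

WHY.  F298 asks, around every point, a cube chart with BOTH printed first-order letters of [B11] Thm 1 (9): `‖A‖ ≤ c₀t∕M` and `‖∇A‖ ≤ c₁t∕M²`.  The second is the one no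
explicit gauge supplies (axial gauges accumulate `≍ ℓM` plaquette gradients transversally; gen 91's (PG) road asked those to be `O(t∕M³)` uniformly in `k`, which is false by
`log M`, memo §1–§2).  In a lattice LANDAU gauge it is a CONSEQUENCE of the sup letter: the lattice Hodge identity + R37 ((156)–(158)) bound `∇A` by `ρ∕R + R·(current +
reaction + a priori·(e^{4ρ}−1))`, the current of OUR tangent-critical configurations is `≲ r∕M³` (F296 → F301), and F299's distance-weighted bootstrap absorbs the a priori
term ON A CUBE without logarithm (F300).  So the chart input of route 1's END drops to: a local unitary gauge on a cube of `≍ 2ℓ + 32` blocks in which `U` reads `e^{A}` with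
`‖A‖ ≤ c₀t∕M` and small Landau reaction — [Balaban1985RegularSpaces] Thm 2 (1.36) FIRST clause + (1.38) TYPE at `U₀ = 1`, LOCALLY; equivalently the target of a one-scale
lattice Uhlenbeck lemma (memo §4 (B2)), since the cube is in the small-curvature regime `ℓ²r ≪ 1`.
WHAT ([folklore] composition + arithmetic; 0 def, 0 sorry).  §1 `gradLetter_arith` (the letters' arithmetic), **`cubeChart_of_landauSup`** (F300 at `R₀ = (nbRad+2ℓ+12)M + 2`,
`D₀ = M`, current `C·r∕M³`, regime `t ≤ 1∕(1024(2ℓ+32)(c₀+1))`: gradient `≤ (62c₀ + (2ℓ+32)²(2C + 32c₀ + 48 + 2c_r))·t∕M²` on the cube of radius `(nbRad+2ℓ+11)M`).  §2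
**`hint_of_landauSupChart_SU2`**: ∀ `A ≥ 0`, `p` ∃ `ℓ ≥ 1`, `ε₀ > 0` ∀ `0 < ε ≤ ε₀` ∃ `β₀ > 0` ∀ `0 < β ≤ β₀` ∀ `N ≥ 1` ∀ `c₀, c_r ∈ [0, A(ℓ+1)^p]`: route Π's two lines ∧ (LSUP
on the `(4ℓ+64)`-fold cover) ∧ hleaves ⟹ (8)∃.
HONEST FRAMING (page 1): (LSUP) — the local Landau gauge with the sup letter and the reaction letter — is a HYPOTHESIS ([B8] Thm 2 (1.36)₁∕(1.38) TYPE; ROAD (U) (B2) is to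
prove it), asserted for nothing; hleaves ([B11] Prop 2 TYPE) likewise; nothing of Bałaban's asserted as an axiom; NE7 NOT PROVED unconditionally; spine 0∕9; finite T⁴ rung
(B)+1 — NOT infinite volume, NOT mass gap, NOT `BetaPertH`, NOT Clay.  Continuum YM on T⁴ ⇐ BetaPertH ∧ nine spine estimates (0/9 proved); BetaPertH ⇐ (D1) ∧ (D4) ∧
CAP+tail; G-an2-4 gates asym, D1 and NE2/3/4.  No `sorry`; axioms ⊆ {propext, Classical.choice, Quot.sound}.
-/

set_option autoImplicit false

open scoped BigOperators Matrix Matrix.Norms.L2Operator Topology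
open NormedSpace Finset Set Filter

namespace Summit.QuantumFields.BalabanUV.T4Continuum.NE7HintOfLandauSupChartSU2

open Literature.MathematicalPhysics.QuantumFieldTheory.Balaban1983to89
open B7Prop1Explicit B7Prop2Explicit MatrixLog UnitaryModel
open B4TorusKernel.MultiPeriod (torusSupNorm)
open B8Ineq132 (covDiv)
open T4AveragingDeficitWall (Ad IsUnitaryCfg IsSkewDir SmallField vary curl curlSq dirSq dirL1)
open T4AveragingDeficitWallBoundary (IsPeriodicCfg periodBox)
open AveragingDeficitPeriodicCounting (IsPeriodicDir)
open AveragingDeficitMultiLevelPrep (LevelSmall tower TangentIter)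
open BlockAverageVaryHolo (nbRad)
open MinimalActionLevels (perWin)
open MinimalActionSandwich (IsMinimiser admissible)
open MinimalActionRate (sfClass)
open NE3HessForm (dAction)
open NE3SlicePoincareBudgetLine (CPLine)
open NE3TangentCovariantTower (dirIter)
open NE3DecomposedRepOfLinearNormalPart (ResidualSliceRepT)
open NE3QbarIterCovLiftPrep (cruxC)
open NE3SmoothRightInverseW (rightInvW)
open NE3RightInverseSolveLetters (thetaLoc)
open NE3RightInverseL2Letter (l2C)
open NE3HatInvCurlLetters (curl2C curl1C)
open NE3EnergyShapes (IsUnitarySite)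
open BlockAveragePushDirSplit (flat)
open NE7HintOfCubeChartSU2 (hint_of_cubeChart_SU2)
open NE7CubeGradientOfLandauSup (norm_fdiff_le_of_landauSup_cube)
open NE7ClassCurrentBound (exists_classCurrentConst)
open Literature.NumberTheory.Sieve.SquarefreeSums (exp_sub_one_le_two_mul)

noncomputable section

variable {n : Type*} [Fintype n] [DecidableEq n]

/-! ## §1 The gradient letter of the cube chart from the sup letter (F300 + F301 + arithmetic) -/

set_option maxHeartbeats 800000 in
/-- The letters' arithmetic: with `ρ = c₀t∕M`, `M ≥ 2`, `0 ≤ r ≤ t ≤ 1`, `t ≤ 1∕(1024·L′·(c₀+1))`, `L′ ≥ 32`: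
`(6ρ + 14·4·ρ + 2(L′M)²·((C·r∕M³ + 4·((r∕M²)·((e^{2ρ}−1) + 2(r∕M²)(2 + r∕M²)))) + c_r·t∕M³))∕M ≤ (62c₀ + L′²(2C + 32c₀ + 48 + 2c_r))·t∕M²`. [folklore] -/
theorem gradLetter_arith {M L' r t c₀ c_r C : ℝ} (hM : 2 ≤ M) (hL' : 32 ≤ L') (hr0 : 0 ≤ r) (hrt : r ≤ t) (ht1 : t ≤ 1) (hc₀ : 0 ≤ c₀) (hC : 0 ≤ C)
    (ht : t ≤ 1 / (1024 * L' * (c₀ + 1))) :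
    (6 * (c₀ * t / M) + 14 * (((3 + 1 : ℕ) : ℝ)) * (c₀ * t / M)
        + 2 * (L' * M) ^ 2 * ((C * r / M ^ 3 + (((3 + 1 : ℕ) : ℝ)) * (r / M ^ 2 * ((Real.exp (2 * (c₀ * t / M)) - 1) + 2 * (r / M ^ 2) * (2 + r / M ^ 2))))
            + c_r * t / M ^ 3)) / M
      ≤ (62 * c₀ + L' ^ 2 * (2 * C + 32 * c₀ + 48 + 2 * c_r)) * t / M ^ 2 := by
  have hM0 : 0 < M := by linarith
  have ht0 : 0 ≤ t := hr0.trans hrt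
  have hρ0 : 0 ≤ c₀ * t / M := by positivity
  -- `2ρ ≤ 1`
  have hct : c₀ * t ≤ 1 / 1024 := by
    have h1 : (c₀ + 1) * t ≤ 1 / (1024 * L') := by
      rw [le_div_iff₀ (by positivity)] at ht; rw [le_div_iff₀ (by positivity)]; nlinarith
    have h2 : 1 / (1024 * L') ≤ 1 / 1024 := by
      apply div_le_div_of_nonneg_left (by norm_num) (by norm_num); nlinarith
    nlinarith
  have hρ1 : 2 * (c₀ * t / M) ≤ 1 := by
    rw [show 2 * (c₀ * t / M) = 2 * (c₀ * t) / M by ring, div_le_one hM0]; nlinarith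
  have hexp : Real.exp (2 * (c₀ * t / M)) - 1 ≤ 4 * (c₀ * t / M) := by
    have := exp_sub_one_le_two_mul (by positivity : 0 ≤ 2 * (c₀ * t / M)) hρ1; linarith
  rw [show (((3 + 1 : ℕ) : ℝ)) = 4 by norm_num]
  -- termwise, everything over the common form `X·t∕M²`
  have hM2 : M ^ 2 ≤ M ^ 3 := by nlinarith [sq_nonneg M]
  have hrM : r / M ^ 2 ≤ 1 := by rw [div_le_one (by positivity)]; nlinarith
  have e0 : (6 * (c₀ * t / M) + 14 * 4 * (c₀ * t / M)) / M = 62 * c₀ * t / M ^ 2 := by field_simp; ring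
  -- the current term
  have e1 : 2 * (L' * M) ^ 2 * (C * r / M ^ 3) / M = 2 * L' ^ 2 * C * r / M ^ 2 := by field_simp
  have b1 : 2 * L' ^ 2 * C * r / M ^ 2 ≤ 2 * L' ^ 2 * C * t / M ^ 2 := by
    apply div_le_div_of_nonneg_right _ (by positivity); nlinarith [mul_nonneg (sq_nonneg L') hC]
  -- the transport-defect term
  have b2 : 2 * (L' * M) ^ 2 * (4 * (r / M ^ 2 * (Real.exp (2 * (c₀ * t / M)) - 1))) / M ≤ 32 * c₀ * L' ^ 2 * t / M ^ 2 := by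
    have h1 : 2 * (L' * M) ^ 2 * (4 * (r / M ^ 2 * (Real.exp (2 * (c₀ * t / M)) - 1))) / M
        ≤ 2 * (L' * M) ^ 2 * (4 * (r / M ^ 2 * (4 * (c₀ * t / M)))) / M := by
      apply div_le_div_of_nonneg_right _ hM0.le
      have h0 : 0 ≤ 2 * (L' * M) ^ 2 * (4 * (r / M ^ 2)) := by positivity
      have := mul_le_mul_of_nonneg_left hexp h0
      calc 2 * (L' * M) ^ 2 * (4 * (r / M ^ 2 * (Real.exp (2 * (c₀ * t / M)) - 1)))
          = 2 * (L' * M) ^ 2 * (4 * (r / M ^ 2)) * (Real.exp (2 * (c₀ * t / M)) - 1) := by ring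
        _ ≤ 2 * (L' * M) ^ 2 * (4 * (r / M ^ 2)) * (4 * (c₀ * t / M)) := this
        _ = _ := by ring
    have e2 : 2 * (L' * M) ^ 2 * (4 * (r / M ^ 2 * (4 * (c₀ * t / M)))) / M = 32 * c₀ * L' ^ 2 * (r * t) / M ^ 2 := by field_simp; ring
    rw [e2] at h1
    have h3 : 32 * c₀ * L' ^ 2 * (r * t) / M ^ 2 ≤ 32 * c₀ * L' ^ 2 * t / M ^ 2 := by
      apply div_le_div_of_nonneg_right _ (by positivity)
      have : r * t ≤ t := by nlinarith
      have : 0 ≤ 32 * c₀ * L' ^ 2 := by positivity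
      nlinarith
    linarith
  -- the inversion-defect term
  have b3 : 2 * (L' * M) ^ 2 * (4 * (r / M ^ 2 * (2 * (r / M ^ 2) * (2 + r / M ^ 2)))) / M ≤ 48 * L' ^ 2 * t / M ^ 2 := by
    have hx0 : 0 ≤ r / M ^ 2 := div_nonneg hr0 (sq_nonneg M)
    have h1 : 2 * (r / M ^ 2) * (2 + r / M ^ 2) ≤ 6 * (r / M ^ 2) := by
      have : (r / M ^ 2) * (r / M ^ 2) ≤ (r / M ^ 2) * 1 := mul_le_mul_of_nonneg_left hrM hx0
      nlinarith
    have h2 : 2 * (L' * M) ^ 2 * (4 * (r / M ^ 2 * (2 * (r / M ^ 2) * (2 + r / M ^ 2)))) / M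
        ≤ 2 * (L' * M) ^ 2 * (4 * (r / M ^ 2 * (6 * (r / M ^ 2)))) / M := by
      apply div_le_div_of_nonneg_right _ hM0.le
      have h0 : 0 ≤ 2 * (L' * M) ^ 2 * (4 * (r / M ^ 2)) := by positivity
      have := mul_le_mul_of_nonneg_left h1 h0
      calc 2 * (L' * M) ^ 2 * (4 * (r / M ^ 2 * (2 * (r / M ^ 2) * (2 + r / M ^ 2))))
          = 2 * (L' * M) ^ 2 * (4 * (r / M ^ 2)) * (2 * (r / M ^ 2) * (2 + r / M ^ 2)) := by ring
        _ ≤ 2 * (L' * M) ^ 2 * (4 * (r / M ^ 2)) * (6 * (r / M ^ 2)) := this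
        _ = _ := by ring
    have e3 : 2 * (L' * M) ^ 2 * (4 * (r / M ^ 2 * (6 * (r / M ^ 2)))) / M = 48 * L' ^ 2 * (r * r) / M ^ 3 := by field_simp; ring
    rw [e3] at h2
    have h3 : 48 * L' ^ 2 * (r * r) / M ^ 3 ≤ 48 * L' ^ 2 * t / M ^ 2 := by
      rw [div_le_div_iff₀ (by positivity) (by positivity)]
      have : r * r ≤ t := by nlinarith
      have : 0 ≤ 48 * L' ^ 2 := by positivity
      have hrr : r * r ≤ t := by nlinarith
      have h4 : 48 * L' ^ 2 * (r * r) ≤ 48 * L' ^ 2 * t := mul_le_mul_of_nonneg_left hrr (by positivity)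
      have h5 : 0 ≤ 48 * L' ^ 2 * t := by positivity
      calc 48 * L' ^ 2 * (r * r) * M ^ 2 ≤ 48 * L' ^ 2 * t * M ^ 2 := mul_le_mul_of_nonneg_right h4 (by positivity)
        _ ≤ 48 * L' ^ 2 * t * M ^ 3 := mul_le_mul_of_nonneg_left hM2 h5
    linarith
  -- the reaction term
  have e4 : 2 * (L' * M) ^ 2 * (c_r * t / M ^ 3) / M = 2 * c_r * L' ^ 2 * t / M ^ 2 := by field_simp
  -- assemble
  have hsplit : (6 * (c₀ * t / M) + 14 * 4 * (c₀ * t / M)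
        + 2 * (L' * M) ^ 2 * ((C * r / M ^ 3 + 4 * (r / M ^ 2 * ((Real.exp (2 * (c₀ * t / M)) - 1) + 2 * (r / M ^ 2) * (2 + r / M ^ 2))))
            + c_r * t / M ^ 3)) / M
      = (6 * (c₀ * t / M) + 14 * 4 * (c₀ * t / M)) / M + 2 * (L' * M) ^ 2 * (C * r / M ^ 3) / M
        + 2 * (L' * M) ^ 2 * (4 * (r / M ^ 2 * (Real.exp (2 * (c₀ * t / M)) - 1))) / M
        + 2 * (L' * M) ^ 2 * (4 * (r / M ^ 2 * (2 * (r / M ^ 2) * (2 + r / M ^ 2)))) / M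
        + 2 * (L' * M) ^ 2 * (c_r * t / M ^ 3) / M := by ring
  rw [hsplit, e0, e1, e4]
  have hfin : 62 * c₀ * t / M ^ 2 + 2 * L' ^ 2 * C * t / M ^ 2 + 32 * c₀ * L' ^ 2 * t / M ^ 2 + 48 * L' ^ 2 * t / M ^ 2 + 2 * c_r * L' ^ 2 * t / M ^ 2
      = (62 * c₀ + L' ^ 2 * (2 * C + 32 * c₀ + 48 + 2 * c_r)) * t / M ^ 2 := by ring
  linarith

set_option maxHeartbeats 800000 in
/-- **THE CUBE CHART OF F298 FROM A LOCAL LANDAU CHART WITH THE SUP LETTER.**  `d = 4`, `L = 2`, block `M = 2^{k+1}`, `t = r + 4(e^β − 1) + ε`: for `U` with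
`SmallField U (r∕M²)` and current `‖covDiv 1 U ν y‖ ≤ C·r∕M³` everywhere, a unitary site gauge `u₀` and `A` with `U^{u₀} = e^{A}` and `‖A‖ ≤ c₀t∕M` on the sup-cube of radius
`R₀ = (nbRad 4 2 + 2ℓ + 12)·M + 2` about `z` and reaction `‖∇div A‖ ≤ c_r t∕M³` on the cube of radius `R₀ − 2`, in the regime `t ≤ 1∕(1024(2ℓ+32)(c₀+1))`:
`‖A(p + e_τ, μ) − A(p, μ)‖ ≤ (62c₀ + (2ℓ+32)²(2C + 32c₀ + 48 + 2c_r))·t∕M²` for `|p − z|_∞ ≤ (nbRad 4 2 + 2ℓ + 11)·M` (F300 at depth `M`, §1's arithmetic). [folklore] -/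
theorem cubeChart_of_landauSup [Nonempty n] (ℓ k : ℕ) {U : Site 4 → Fin 4 → (Matrix n n ℂ)ˣ} {r ε β c₀ c_r C : ℝ}
    (hr0 : 0 ≤ r) (hε0 : 0 ≤ ε) (hβ0 : 0 ≤ β) (hc₀ : 0 ≤ c₀) (hc_r : 0 ≤ c_r) (hC : 0 ≤ C)
    (ht : r + 4 * (Real.exp β - 1) + ε ≤ 1 / (1024 * (2 * (ℓ : ℝ) + 32) * (c₀ + 1)))
    (hUr : SmallField U (r / (((2 : ℕ) : ℝ) ^ (k + 1)) ^ 2))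
    (hcur : ∀ (ν : Fin 4) (y : Site 4), ‖covDiv 1 U ν y‖ ≤ C * r / (((2 : ℕ) : ℝ) ^ (k + 1)) ^ 3)
    {u₀ : Site 4 → (Matrix n n ℂ)ˣ} (hu₀ : IsUnitarySite u₀) {A : Site 4 → Fin 4 → Matrix n n ℂ} (z : Site 4)
    (hUA : ∀ (p : Site 4) (μ : Fin 4), (∀ i, |p i - z i| ≤ (((nbRad 4 2 + 2 * ℓ + 12) * 2 ^ (k + 1) + 2 : ℕ) : ℤ)) → gaugeAct u₀ U p μ = expUnit (A p μ))
    (hA0 : ∀ (p : Site 4) (μ : Fin 4), (∀ i, |p i - z i| ≤ (((nbRad 4 2 + 2 * ℓ + 12) * 2 ^ (k + 1) + 2 : ℕ) : ℤ)) →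
      ‖A p μ‖ ≤ c₀ * (r + 4 * (Real.exp β - 1) + ε) / ((2 : ℕ) : ℝ) ^ (k + 1))
    (hAr : ∀ (p : Site 4) (ν : Fin 4), (∀ i, |p i - z i| ≤ (((nbRad 4 2 + 2 * ℓ + 12) * 2 ^ (k + 1) : ℕ) : ℤ)) →
      ‖∑ μ, (A (p + e ν) μ - A (p + e ν - e μ) μ) - ∑ μ, (A p μ - A (p - e μ) μ)‖
        ≤ c_r * (r + 4 * (Real.exp β - 1) + ε) / (((2 : ℕ) : ℝ) ^ (k + 1)) ^ 3)
    (p : Site 4) (μ τ : Fin 4) (hp : ∀ i, |p i - z i| ≤ (((nbRad 4 2 + 2 * ℓ + 11) * 2 ^ (k + 1) : ℕ) : ℤ)) :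
    ‖A (p + e τ) μ - A p μ‖
      ≤ (62 * c₀ + (2 * (ℓ : ℝ) + 32) ^ 2 * (2 * C + 32 * c₀ + 48 + 2 * c_r)) * (r + 4 * (Real.exp β - 1) + ε) / (((2 : ℕ) : ℝ) ^ (k + 1)) ^ 2 := by
  -- letters
  have hM2n : 2 ≤ 2 ^ (k + 1) := by
    calc 2 = 2 ^ 1 := by norm_num
      _ ≤ 2 ^ (k + 1) := Nat.pow_le_pow_right (by norm_num) (by omega)
  have hMr' : ((2 : ℕ) : ℝ) ^ (k + 1) = ((2 ^ (k + 1) : ℕ) : ℝ) := by rw [Nat.cast_pow]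
  have hnb : nbRad 4 2 = 20 := by unfold BlockAverageVaryHolo.nbRad; norm_num
  rw [hnb] at hUA hA0 hAr hp
  rw [hMr'] at hUr hcur hA0 hAr ⊢
  generalize hMdef : 2 ^ (k + 1) = Mn at *
  have hMr : (2 : ℝ) ≤ (Mn : ℝ) := by exact_mod_cast hM2n
  have hM0 : (0 : ℝ) < (Mn : ℝ) := by linarith
  set t : ℝ := r + 4 * (Real.exp β - 1) + ε with htdef
  have hβ' : 0 ≤ 4 * (Real.exp β - 1) := by nlinarith [Real.add_one_le_exp β]
  have hrt : r ≤ t := by rw [htdef]; linarith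
  have ht0 : 0 ≤ t := hr0.trans hrt
  have hℓ0 : (0 : ℝ) ≤ (ℓ : ℝ) := Nat.cast_nonneg ℓ
  have hL' : (32 : ℝ) ≤ 2 * (ℓ : ℝ) + 32 := by linarith
  have ht1 : t ≤ 1 := ht.trans (by rw [div_le_one (by positivity)]; nlinarith)
  -- the absorption condition `32·4·(R₀−2)·(e^{4ρ}−1) ≤ 1`
  have hρ0 : 0 ≤ c₀ * t / (Mn : ℝ) := by positivity
  have hct : (c₀ + 1) * t ≤ 1 / (1024 * (2 * (ℓ : ℝ) + 32)) := by
    rw [le_div_iff₀ (by positivity)] at ht; rw [le_div_iff₀ (by positivity)]; nlinarith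
  have h4ρ : 4 * (c₀ * t / (Mn : ℝ)) ≤ 1 := by
    rw [show 4 * (c₀ * t / (Mn : ℝ)) = 4 * (c₀ * t) / Mn by ring, div_le_one hM0]
    have h2 : 1 / (1024 * (2 * (ℓ : ℝ) + 32)) ≤ 1 / 1024 := by
      apply div_le_div_of_nonneg_left (by norm_num) (by norm_num); nlinarith
    nlinarith
  have hexp4 : Real.exp (4 * (c₀ * t / (Mn : ℝ))) - 1 ≤ 8 * (c₀ * t / (Mn : ℝ)) := by
    have := exp_sub_one_le_two_mul (by positivity : 0 ≤ 4 * (c₀ * t / (Mn : ℝ))) h4ρ; linarith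
  have hR2 : (((20 + 2 * ℓ + 12) * Mn + 2 - 2 : ℕ) : ℝ) = (2 * (ℓ : ℝ) + 32) * Mn := by
    rw [Nat.add_sub_cancel]; push_cast; ring
  have hs : 32 * ((3 + 1 : ℕ) : ℝ) * (((20 + 2 * ℓ + 12) * Mn + 2 - 2 : ℕ) : ℝ) * (Real.exp (4 * (c₀ * t / (Mn : ℝ))) - 1) ≤ 1 := by
    rw [hR2, show ((3 + 1 : ℕ) : ℝ) = 4 by norm_num]
    have h1 : 32 * 4 * ((2 * (ℓ : ℝ) + 32) * Mn) * (Real.exp (4 * (c₀ * t / (Mn : ℝ))) - 1)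
        ≤ 32 * 4 * ((2 * (ℓ : ℝ) + 32) * Mn) * (8 * (c₀ * t / (Mn : ℝ))) := mul_le_mul_of_nonneg_left hexp4 (by positivity)
    have e1 : 32 * 4 * ((2 * (ℓ : ℝ) + 32) * Mn) * (8 * (c₀ * t / (Mn : ℝ))) = 1024 * (2 * (ℓ : ℝ) + 32) * (c₀ * t) := by field_simp; ring
    rw [e1] at h1
    have h3 : 1024 * (2 * (ℓ : ℝ) + 32) * (c₀ * t) ≤ 1 := by
      have h4 : c₀ * t ≤ (c₀ + 1) * t := by nlinarith
      have h5 := mul_le_mul_of_nonneg_left (h4.trans hct) (by positivity : (0 : ℝ) ≤ 1024 * (2 * (ℓ : ℝ) + 32))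
      have e2 : 1024 * (2 * (ℓ : ℝ) + 32) * (1 / (1024 * (2 * (ℓ : ℝ) + 32))) = 1 := by field_simp
      linarith
    linarith
  -- F300 at `R₀ = (2ℓ+32)M + 2`, depth `M`
  have hR3 : 3 ≤ (20 + 2 * ℓ + 12) * Mn + 2 := by nlinarith
  have hcast : (((20 + 2 * ℓ + 12) * Mn + 2 : ℕ) : ℤ) - 2 = (((20 + 2 * ℓ + 12) * Mn : ℕ) : ℤ) := by push_cast; ring
  have h := norm_fdiff_le_of_landauSup_cube (d := 3) (n := n) (ε := r / (Mn : ℝ) ^ 2) (by positivity) hUr hu₀ z ((20 + 2 * ℓ + 12) * Mn + 2) hR3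
    (ρ := c₀ * t / (Mn : ℝ)) (j := C * r / (Mn : ℝ) ^ 3) (r := c_r * t / (Mn : ℝ) ^ 3) hρ0 (by positivity) (by positivity) hUA hA0
    (fun y ν hy => hcur ν y) (fun y ν hy => hAr y ν fun i => by rw [← hcast]; exact hy i) hs p Mn (by omega)
    (fun i => by have := hp i; push_cast at this ⊢; nlinarith [this]) μ τ
  rw [hR2] at h
  refine h.trans ?_
  have key := gradLetter_arith (M := (Mn : ℝ)) (L' := 2 * (ℓ : ℝ) + 32) (C := C) (c_r := c_r) hMr hL' hr0 hrt ht1 hc₀ hC ht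
  refine le_trans (le_of_eq ?_) key
  ring

/-! ## §2 (8)∃ from the local Landau chart with the sup letter -/

set_option maxHeartbeats 1600000 in
/-- **F302 — (8)∃ FROM A LOCAL LATTICE-LANDAU CHART WITH THE SUP LETTER, SU(2)∕U(2) on T⁴, `L = 2`.**  [Balaban1985Variational] Thm 1 (8) ∘ Prop 8 ∘
[Balaban1985RegularSpaces] Thm 2 (1.36)₁∕(1.38) TYPE, rows NE7 ∘ NE3, `card n = 2`: for all `A ≥ 0` and `p` there are `ℓ ≥ 1`, `ε₀ > 0` and, for every `0 < ε ≤ ε₀`, a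
`β₀ > 0` such that for `0 < β ≤ β₀`, every period `N ≥ 1` and all `c₀, c_r ∈ [0, A(ℓ+1)^p]`: IF route Π's two `k`-free lines, (LSUP) — around every point `z` of every
tangent-critical admissible configuration on the `(4ℓ+64)`-fold cover with small field `r ≤ ε∕4`: a unitary site gauge `u₀` and `A₀` with `U^{u₀} = e^{A₀}`, `A₀` skew,
`‖A₀‖ ≤ c₀t∕M` on the sup-cube of radius `(nbRad 4 2 + 2ℓ + 12)·M + 2`, and Landau reaction `‖∇div A₀‖ ≤ c_r t∕M³` on the cube of radius `(nbRad 4 2 + 2ℓ + 12)·M` —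
and row NE3's `hleaves` hold, THEN for some `δ_V > 0`, over `{V | unitary, N-periodic, SmallField V δ_V}`, at every level some constrained minimiser over `sfClass 4 2 N ε`
is `SmallField U a` with `0 ≤ a < ε∕(2^k)²`.  The GRADIENT letter of the chart is discharged (§1); NE7 is NOT proved unconditionally ((LSUP), `hleaves`, the two lines
remain). -/
theorem hint_of_landauSupChart_SU2 [Nonempty n] (hn : Fintype.card n = 2) {A : ℝ} (hA : 0 ≤ A) (p : ℕ) :
    ∃ ℓ : ℕ, 1 ≤ ℓ ∧ ∃ ε₀ : ℝ, 0 < ε₀ ∧ ∀ ε : ℝ, 0 < ε → ε ≤ ε₀ → ∃ β₀ : ℝ, 0 < β₀ ∧ ∀ β : ℝ, 0 < β → β ≤ β₀ →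
    ∀ (N : ℕ) [NeZero N] (C₂ αh Ch νh κh c₀ c_r : ℝ), 1 ≤ N →
    0 ≤ C₂ → 0 ≤ αh → αh ≤ 1 → 0 ≤ Ch →
    νh = 2 * Real.sqrt (l2C 4 2 / (1 - thetaLoc 4 2 * ε) ^ 2 + curl2C 4 2 / (1 - thetaLoc 4 2 * ε) ^ 2) * C₂ * Ch * αh →
    κh = 4 * (curl1C 4 2 / (1 - thetaLoc 4 2 * ε)) * C₂ * Ch ^ 2 * ε →
    νh < 1 →
    2 * (κh / (1 - νh) ^ 2) < ((((1 / 2 - (νh / (1 - νh)) ^ 2) / (2 * (1 + (CPLine 4 2 2 (1 / 10 ^ 17) (1 / 10 ^ 53) + 1))) - (νh / (1 - νh)) ^ 2) / 2 - 576 * ((4 : ℕ) : ℝ) * (αh ^ 2 * Real.exp (2 * αh))) / (Fintype.card n : ℝ) - 28 * ((4 : ℕ) : ℝ) * (ε + 7 * αh ^ 2)) →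
    0 ≤ c₀ → c₀ ≤ A * ((ℓ : ℝ) + 1) ^ p → 0 ≤ c_r → c_r ≤ A * ((ℓ : ℝ) + 1) ^ p →
    -- (LSUP): the local lattice-Landau chart with the sup letter and the reaction letter, on the `(4ℓ+64)`-fold cover
    (∀ D : Site 4 → Fin 4 → (Matrix n n ℂ)ˣ, IsUnitaryCfg D → IsPeriodicCfg D ((N * (4 * ℓ + 64)) : ℤ) → SmallField D (4 * (Real.exp β - 1)) →
      ∀ (k : ℕ), ∀ U ∈ admissible (sfClass 4 2 (N * (4 * ℓ + 64)) ε) 2 (k + 1) D,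
      (∀ φ : Site 4 → Fin 4 → Matrix n n ℂ, IsSkewDir φ → IsPeriodicDir φ (((N * (4 * ℓ + 64)) * 2 ^ (k + 1) : ℕ) : ℤ) → TangentIter 2 k U φ →
        dAction U φ (perWin 4 ((N * (4 * ℓ + 64)) * 2 ^ (k + 1))) = 0) →
      ∀ r : ℝ, 0 ≤ r → r ≤ (1 / ((2 : ℕ) : ℝ) ^ 2 * ε) → SmallField U (r / (((2 : ℕ) : ℝ) ^ (k + 1)) ^ 2) →
      ∀ z : Site 4, ∃ (u₀ : Site 4 → (Matrix n n ℂ)ˣ) (A₀ : Site 4 → Fin 4 → Matrix n n ℂ), IsUnitarySite u₀ ∧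
        (∀ (p : Site 4) (μ : Fin 4), (∀ i, |p i - z i| ≤ (((nbRad 4 2 + 2 * ℓ + 12) * 2 ^ (k + 1) + 2 : ℕ) : ℤ)) → gaugeAct u₀ U p μ = expUnit (A₀ p μ)) ∧
        (∀ (p : Site 4) (μ : Fin 4), (∀ i, |p i - z i| ≤ (((nbRad 4 2 + 2 * ℓ + 12) * 2 ^ (k + 1) + 2 : ℕ) : ℤ)) → A₀ p μ ∈ skewAdjoint (Matrix n n ℂ)) ∧
        (∀ (p : Site 4) (μ : Fin 4), (∀ i, |p i - z i| ≤ (((nbRad 4 2 + 2 * ℓ + 12) * 2 ^ (k + 1) + 2 : ℕ) : ℤ)) →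
          ‖A₀ p μ‖ ≤ c₀ * (r + 4 * (Real.exp β - 1) + ε) / ((2 : ℕ) : ℝ) ^ (k + 1)) ∧
        (∀ (p : Site 4) (ν : Fin 4), (∀ i, |p i - z i| ≤ (((nbRad 4 2 + 2 * ℓ + 12) * 2 ^ (k + 1) : ℕ) : ℤ)) →
          ‖∑ μ, (A₀ (p + e ν) μ - A₀ (p + e ν - e μ) μ) - ∑ μ, (A₀ p μ - A₀ (p - e μ) μ)‖
            ≤ c_r * (r + 4 * (Real.exp β - 1) + ε) / (((2 : ℕ) : ℝ) ^ (k + 1)) ^ 3)) →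
    -- ROW NE3's PER-PAIR BINDER on the data class (F31's `hleaves`)
    (∀ D : Site 4 → Fin 4 → (Matrix n n ℂ)ˣ, IsUnitaryCfg D → IsPeriodicCfg D (N : ℤ) → SmallField D (4 * (Real.exp β - 1)) → ∀ (k : ℕ), ∀ Us ∈ admissible (sfClass 4 2 N ε) 2 (k + 1) D, SmallField Us ((1 / ((2 : ℕ) : ℝ) ^ 2 * ε / 2) / (((2 : ℕ) : ℝ) ^ (k + 1)) ^ 2) → (∀ φ : Site 4 → Fin 4 → Matrix n n ℂ, IsSkewDir φ → IsPeriodicDir φ ((N * 2 ^ (k + 1) : ℕ) : ℤ) → TangentIter 2 k Us φ → dAction Us φ (perWin 4 (N * 2 ^ (k + 1))) = 0) → ∀ U' ∈ admissible (sfClass 4 2 N ε) 2 (k + 1) D, ∃ (u : Site 4 → (Matrix n n ℂ)ˣ) (X₀ : Site 4 → Fin 4 → Matrix n n ℂ) (α₀ : ℝ) (m : Site 4 → Fin 4 → ℝ) (C : ℝ), IsSkewDir X₀ ∧ (∀ (hWu : IsUnitaryCfg Us) (hx : 0 ≤ ε / (((2 : ℕ) : ℝ) ^ (k + 1)) ^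 2) (hs : LevelSmall 4 2 k (ε / (((2 : ℕ) : ℝ) ^ (k + 1)) ^ 2)) (hWx : SmallField Us (ε / (((2 : ℕ) : ℝ) ^ (k + 1)) ^ 2)) (hθ : cruxC 4 2 * ((((2 : ℕ) : ℝ) ^ (k + 1)) ^ 2 * (ε / (((2 : ℕ) : ℝ) ^ (k + 1)) ^ 2)) < 1) (hφ : IsSkewDir (dirIter 2 (k + 1) Us X₀)), ResidualSliceRepT 2 N (k + 1) Us U' u X₀ (rightInvW (by norm_num) k hWu hx hs hWx N hθ hφ) α₀) ∧ (∀ z κ, 0 ≤ m z κ) ∧ 0 ≤ C ∧ (((2 : ℕ) : ℝ) ^ (k + 1)) ^ 4 * ∑ z ∈ periodBox (d := 4) N, ∑ κ : Fin 4, m z κ ^ 2 ≤ C ^ 2 * dirSq X₀ (periodBox (d := 4) (N * 2 ^ (k + 1))) ∧ (∀ z ∈ periodBox (d := 4) N, ∀ κ : Fin 4, ‖dirIter 2 (k + 1) Us X₀ z κ‖ ≤ C₂ * (((2 : ℕ) : ℝ) ^ (k + 1) * m z κ) ^ 2) ∧ α₀ * ((2 : ℕ) : ℝ) ^ (k + 1)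 ≤ αh ∧ (∀ z κ, m z κ * ((2 : ℕ) : ℝ) ^ (k + 1) ≤ αh) ∧ C ≤ Ch) →
    ∃ δV : ℝ, 0 < δV ∧
      ∀ V ∈ {V : Site 4 → Fin 4 → (Matrix n n ℂ)ˣ | IsUnitaryCfg V ∧ IsPeriodicCfg V (N : ℤ) ∧ SmallField V δV},
      ∀ k : ℕ, ∃ U : Site 4 → Fin 4 → (Matrix n n ℂ)ˣ, IsMinimiser 4 (sfClass 4 2 N ε) 2 N k V U ∧
        ∃ a : ℝ, 0 ≤ a ∧ a < ε / (((2 : ℕ) : ℝ) ^ k) ^ 2 ∧ SmallField U a := by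
  obtain ⟨C, hC0, hC⟩ := exists_classCurrentConst (n := n)
  -- the polynomial bound of the derived gradient constant
  set A' : ℝ := 62 * A + 1024 * (2 * C + 48) + 34816 * A with hA'
  have hA'0 : 0 ≤ A' := by positivity
  obtain ⟨ℓ, hℓ1, ε₀, hε₀, H⟩ := hint_of_cubeChart_SU2 (n := n) hn (A := A') hA'0 (p + 2)
  have hℓ0 : (0 : ℝ) ≤ (ℓ : ℝ) := Nat.cast_nonneg ℓ
  set T : ℝ := 1 / (1024 * (2 * (ℓ : ℝ) + 32) * (A * ((ℓ : ℝ) + 1) ^ p + 1)) with hT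
  have hT0 : 0 < T := by positivity
  refine ⟨ℓ, hℓ1, min ε₀ (min (1 / 10 ^ 53) (T / 3)), lt_min hε₀ (lt_min (by norm_num) (by positivity)), fun ε hε hεle => ?_⟩
  obtain ⟨β₀, hβ₀, H2⟩ := H ε hε (hεle.trans (min_le_left _ _))
  refine ⟨min β₀ (min 1 (T / 24)), lt_min hβ₀ (lt_min one_pos (by positivity)), ?_⟩
  intro β hβ hβle N _ C₂ αh Ch νh κh c₀ c_r hN hC₂ hαh0 hαh1 hCh0 hνh hκh hν hline hc₀ hc₀b hc_r hc_rb hLSUP hleaves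
  have hε53 : ε ≤ 1 / 10 ^ 53 := hεle.trans ((min_le_right _ _).trans (min_le_left _ _))
  have hεT : ε ≤ T / 3 := hεle.trans ((min_le_right _ _).trans (min_le_right _ _))
  have hβ1 : β ≤ 1 := hβle.trans ((min_le_right _ _).trans (min_le_left _ _))
  have hβT : β ≤ T / 24 := hβle.trans ((min_le_right _ _).trans (min_le_right _ _))
  have hexpβ : 4 * (Real.exp β - 1) ≤ T / 3 := by
    have h := exp_sub_one_le_two_mul hβ.le hβ1; linarith
  -- the derived gradient constant and its polynomial bound
  set c₁ : ℝ := 62 * c₀ + (2 * (ℓ : ℝ) + 32) ^ 2 * (2 * C + 32 * c₀ + 48 + 2 * c_r) with hc₁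
  have hc₁0 : 0 ≤ c₁ := by positivity
  have hpow0 : (1 : ℝ) ≤ ((ℓ : ℝ) + 1) ^ p := one_le_pow₀ (by linarith)
  have hpow2 : ((ℓ : ℝ) + 1) ^ p ≤ ((ℓ : ℝ) + 1) ^ (p + 2) := pow_le_pow_right₀ (by linarith) (by omega)
  have hsq : (2 * (ℓ : ℝ) + 32) ^ 2 ≤ 1024 * ((ℓ : ℝ) + 1) ^ 2 := by nlinarith
  have hpow_eq : ((ℓ : ℝ) + 1) ^ (p + 2) = ((ℓ : ℝ) + 1) ^ 2 * ((ℓ : ℝ) + 1) ^ p := by ring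
  have hQ : 0 ≤ A * ((ℓ : ℝ) + 1) ^ p := by positivity
  have hc₁b : c₁ ≤ A' * ((ℓ : ℝ) + 1) ^ (p + 2) := by
    have h1 : 2 * C + 32 * c₀ + 48 + 2 * c_r ≤ 2 * C + 48 + 34 * (A * ((ℓ : ℝ) + 1) ^ p) := by linarith
    have h2 : (2 * (ℓ : ℝ) + 32) ^ 2 * (2 * C + 32 * c₀ + 48 + 2 * c_r) ≤ (1024 * ((ℓ : ℝ) + 1) ^ 2) * (2 * C + 48 + 34 * (A * ((ℓ : ℝ) + 1) ^ p)) :=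
      mul_le_mul hsq h1 (by positivity) (by positivity)
    have h3 : 62 * c₀ ≤ 62 * A * ((ℓ : ℝ) + 1) ^ (p + 2) := by nlinarith
    have h4 : (1024 * ((ℓ : ℝ) + 1) ^ 2) * (2 * C + 48 + 34 * (A * ((ℓ : ℝ) + 1) ^ p))
        = 1024 * (2 * C + 48) * ((ℓ : ℝ) + 1) ^ 2 + 34816 * A * ((ℓ : ℝ) + 1) ^ (p + 2) := by rw [hpow_eq]; ring
    have h5 : 1024 * (2 * C + 48) * ((ℓ : ℝ) + 1) ^ 2 ≤ 1024 * (2 * C + 48) * ((ℓ : ℝ) + 1) ^ (p + 2) := by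
      have : ((ℓ : ℝ) + 1) ^ 2 ≤ ((ℓ : ℝ) + 1) ^ (p + 2) := pow_le_pow_right₀ (by linarith) (by omega)
      exact mul_le_mul_of_nonneg_left this (by positivity)
    rw [hc₁, hA']; nlinarith
  have hc₀b' : c₀ ≤ A' * ((ℓ : ℝ) + 1) ^ (p + 2) := by
    have h1 : A * ((ℓ : ℝ) + 1) ^ p ≤ A * ((ℓ : ℝ) + 1) ^ (p + 2) := mul_le_mul_of_nonneg_left hpow2 hA
    have h2 : A * ((ℓ : ℝ) + 1) ^ (p + 2) ≤ A' * ((ℓ : ℝ) + 1) ^ (p + 2) := by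
      apply mul_le_mul_of_nonneg_right _ (by positivity); rw [hA']; nlinarith
    linarith
  refine H2 β hβ (hβle.trans (min_le_left _ _)) N C₂ αh Ch νh κh c₀ c₁ hN hC₂ hαh0 hαh1 hCh0 hνh hκh hν hline hc₀ hc₀b' hc₁0 hc₁b ?_ hleaves
  -- (CUBE) from (LSUP)
  intro D hDu hDP hDs k U hU hcrit r hr0 hr hUr z
  obtain ⟨u₀, A₀, hu₀, hUA, hskew, hA0, hAr⟩ := hLSUP D hDu hDP hDs k U hU hcrit r hr0 hr hUr z
  -- the current of `U` (F301 on the cover)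
  haveI : NeZero (N * (4 * ℓ + 64)) := ⟨mul_ne_zero (NeZero.ne N) (by omega)⟩
  have hr4 : r ≤ ε / 4 := by have e := hr; norm_num at e; linarith
  have hr14 : r ≤ 1 / 4 := by linarith [hε53.trans (by norm_num : (1 : ℝ) / 10 ^ 53 ≤ 1)]
  have hcur := hC (N * (4 * ℓ + 64)) ε hε hε53 D k U hU hcrit r hr0 hr14 hUr
  -- the regime
  have ht : r + 4 * (Real.exp β - 1) + ε ≤ 1 / (1024 * (2 * (ℓ : ℝ) + 32) * (c₀ + 1)) := by
    have h1 : r + 4 * (Real.exp β - 1) + ε ≤ T := by linarith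
    have h2 : T ≤ 1 / (1024 * (2 * (ℓ : ℝ) + 32) * (c₀ + 1)) := by
      rw [hT]; apply div_le_div_of_nonneg_left (by norm_num) (by positivity)
      exact mul_le_mul_of_nonneg_left (by linarith) (by positivity)
    linarith
  -- radii
  have hsub : ∀ (q : Site 4), (∀ i, |q i - z i| ≤ (((nbRad 4 2 + 2 * ℓ + 11) * 2 ^ (k + 1) : ℕ) : ℤ)) →
      ∀ i, |q i - z i| ≤ (((nbRad 4 2 + 2 * ℓ + 12) * 2 ^ (k + 1) + 2 : ℕ) : ℤ) := fun q hq i =>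
    (hq i).trans (by push_cast; nlinarith [show (1 : ℤ) ≤ 2 ^ (k + 1) by exact_mod_cast Nat.one_le_two_pow])
  refine ⟨u₀, A₀, hu₀, fun q μ hq => hUA q μ (hsub q hq), fun q μ hq => hskew q μ (hsub q hq), fun q μ hq => hA0 q μ (hsub q hq), fun q μ τ hq _ => ?_⟩
  exact cubeChart_of_landauSup (n := n) ℓ k hr0 hε.le hβ.le hc₀ hc_r hC0 ht hUr hcur hu₀ z hUA hA0 hAr q μ τ hq

end

end Summit.QuantumFields.BalabanUV.T4Continuum.NE7HintOfLandauSupChartSU2
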